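import Summits.BirchSwinnertonDyer.BirchSwinnertonDyer.Theorems.EisensteinPrimesBSDpOnCellCOfCitedFactsR3
import Summits.BirchSwinnertonDyer.BirchSwinnertonDyer.Theorems.EisensteinPrimesBSDpOnCellCKolyvaginOfGZK
import HarnessLib
/-!
# [telescope v21 — LEAD cruxlead-19034 g9, 2026-08-30] CRUX 4 `BSDpOnCellC` FROM THE CITED FACTS WITHOUT KOLYVAGIN'S THEOREM A —
# CONDITIONAL CLOSURE, SORRY-FREE (sibling of p783713 `…OfCitedFactsR3.bsdpOnCellC_of_citedFactsR_pre3` with ONE `hPub` CONJUNCT FEWER; `--supports`, helper; CONDITIONAL — closes nothing)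
# Crux 4 `BSDpOnCellC` (stmt-BirchSwinnertonDyer-19034), line «telescope» v21.

WHAT: `bsdpOnCellC_of_citedFactsR4 (hPub) (hPre) (hRat) (hMazur) : …Theses.EisensteinPrimes.BSDpOnCellC` with `hPre` (Keller–Yin ×3), `hRat` (T-An-2ʳ),
`hMazur` (crux 3) EXACTLY as in p783713, and **`hPub` = telescope v21's `stub_publishedFacts` text with EXACTLY ONE conjunct removed — conjunct 9 of the inner
block, `∀ (N : ℕ) [NeZero N] (W : WeierstrassCurve ℚ) (K : Type) [Field K] [NumberField K], kolyvagin N W K` (Kolyvagin 1990, Thm. A) — every other conjunct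
token-identical and in the same nesting** (22 refereed named facts). PROOF = p783713 fed the rebuilt 23-tuple whose conjunct 9 is the TREE THEOREM
`EisensteinPrimesBSDpOnCellCKolyvaginOfGZK.forall_kolyvagin_of_rank_eq_analyticRank h10 h6 h8` (Kolyvagin's Thm. A at every instance from conjunct 10 = Darmon 2004
Thm. 3.22 `rank_eq_analyticRank_of_analyticRank_le_one`, conjunct 6 = modularity `exists_isNewformOf`, conjunct 8 = Gross–Zagier `gross_zagier`, by the twist
route of `HeegnerPointsKolyvaginExceptionalTwistProofs`; LEAD g9 brick #1). WHY IT IS THERE TO REMOVE: the LEAD g9 kernel-level leaf census of the p783713 cone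
(`Cruxes/BSDpOnCellC/INPUT-LEAF-CENSUS-g9.md`) found `kolyvagin` consumed at ONE leaf (`Rank1Residual.X11b.bsdp_of_indexIdentityAt`) in a cone that also carries Thm. 3.22 by name.
MEANING: the by-name register of crux 4 becomes 22 refereed + KY24 ×3 + T-An-2ʳ + crux 3 = 26 + crux 3 (v21 books 27 + crux 3). HONEST LABELS: in PRINT Thm. 3.22 rests on
Kolyvagin's theorem, so what leaves is a name the register ALREADY SUBSUMES (a redundancy removal, not new mathematics; the print-debt behind Thm. 3.22 is unchanged);
a telescope v22 (`stub_publishedFacts` 23 → 22 under a FRESH name) is the LEAD's registry act under a NEW director word + the full W-79 trail — this file is the kernel evidence for it.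
HONEST FRAMING: CONDITIONAL result (the gate records it as such); it discharges none of its hypotheses; closes no registered stub, no crux, no summit statement; BSD is proved
for no curve by this file. THEOREMS ONLY: no definition, no named fact, no instance, no `sorry`.
References (shape only): [cite: Kolyvagin1990, Thm. A] [cite: Darmon2004, Thm. 3.22] [cite: KellerYin2024, Thm. 3.0.8, Thm. 2.2.2 (arXiv:2402.12781v2)] [cite: GreenbergVatsal2000, Thm. (1.3)]
-/

set_option autoImplicit false
set_option linter.dupNamespace false

noncomputable section

open scoped Classical MatrixGroups ModularForm

open CongruenceSubgroup WeierstrassCurve NumberField IsDedekindDomain Field PowerSeries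
  Literature.NumberTheory.EllipticCurves Literature.NumberTheory.EllipticCurves.GreenbergSelmer
  Literature.NumberTheory.EllipticCurves.ModularForms Literature.NumberTheory.QuadraticFields
  Literature.NumberTheory.EllipticCurves.Rank1Residual
  Literature.NumberTheory.EllipticCurves.Rank1Residual.Typed
  Literature.NumberTheory.EllipticCurves.KrizLi2019
  Literature.NumberTheory.EllipticCurves.GreenbergVatsal2000
  Literature.NumberTheory.EllipticCurves.Wuthrich2014
  Literature.NumberTheory.EllipticCurves.SteinWuthrich2013
  Literature.NumberTheory.EllipticCurves.Castella2018Exceptional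
  Literature.NumberTheory.GaloisRepresentations Literature.NumberTheory.GaloisCohomology
  Literature.NumberTheory.Automorphic
  Summit.BirchSwinnertonDyer.Rank1Residual.X11b.AcSelmer
  Summit.BirchSwinnertonDyer.Rank1Residual.X11b.Halves
  Summit.BirchSwinnertonDyer.Rank1Residual.X11b
  Summit.BirchSwinnertonDyer.Rank1Residual Summit.BirchSwinnertonDyer.Rank1Residual.X1
  Summit.BirchSwinnertonDyer.Rank1Residual.X2
open Literature.NumberTheory.EllipticCurves.KellerYin2024 (curveLocalLambda)


open Literature.NumberTheory.EllipticCurves.BigGaloisRep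

namespace Summit.BirchSwinnertonDyer.BirchSwinnertonDyer.Theorems.EisensteinPrimesBSDpOnCellCOfCitedFactsR4

open Literature.NumberTheory.EllipticCurves.CastellaGrossiLeeSkinner2022 Literature.NumberTheory.EllipticCurves.Castella2018
  Literature.NumberTheory.IwasawaTheory Literature.NumberTheory.IwasawaTheory.Greenberg2016
  Literature.NumberTheory.IwasawaTheory.Greenberg2006
  Summit.BirchSwinnertonDyer.Rank1Residual.X1.KellerYinMuLambdaSplit
open Literature.NumberTheory.EllipticCurves.KellerYin2024
open Summit.BirchSwinnertonDyer.BirchSwinnertonDyer.Theorems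

/-- **Crux 4 `BSDpOnCellC` from 22 refereed facts (NO Kolyvagin), Keller–Yin ×3, T-An-2ʳ and crux 3 (telescope v21 chain; conditional closure).**
Proof = p783713 `bsdpOnCellC_of_citedFactsR_pre3` with the `kolyvagin` conjunct of its `hPub` supplied by the tree theorem
`EisensteinPrimesBSDpOnCellCKolyvaginOfGZK.forall_kolyvagin_of_rank_eq_analyticRank` (from conjuncts 10, 6, 8: Thm. 3.22, modularity, Gross–Zagier).
CONDITIONAL: nothing here discharges the hypotheses. [cite: Kolyvagin1990, Thm. A (shape only)] [cite: Darmon2004, Thm. 3.22 (shape only)] -/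
theorem bsdpOnCellC_of_citedFactsR4
    (hPub :
    ((((lambdaMu_multiplicative_of_gvPar ∧ thm16_charIdeal_dvd_multiplicative_of_reducible ∧
    thm61_splitMultiplicative ∧ thm61_nonsplitMultiplicative ∧
    (∀ (W : WeierstrassCurve ℚ) [W.IsElliptic] [W.IsGloballyMinimal] (p : ℕ) [Fact p.Prime],
      greenberg_stevens (W := W) (p := p)) ∧
    exists_isNewformOf ∧
    hsieh2014_exists_anticyclotomicPAdicLFunction ∧
    (∀ (N : ℕ) [NeZero N] (W : WeierstrassCurve ℚ) (K : Type) [Field K] [NumberField K],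
      gross_zagier N W K) ∧
    rank_eq_analyticRank_of_analyticRank_le_one ∧ HoffsteinLuo1997_exists_twist_L_one_ne_zero ∧
    mazur_not_dvd_maninConstant_of_odd ∧ bsdRHS_eq_of_isIsogenous) ∧
    thm210_thm211_bdpDisplay_pNew) ∧
    LiuZhangZhang2018.thm151_thm153_modularCurve_heegnerVector) ∧
    (prop125_characterGrSelmerDual_torsion_muZero_dim ∧
      cor126_residualCharacter_globalLift ∧ cor126_residualCharacter_localSurjective ∧
      thm212_exists_isKatzLFunction ∧
      Literature.NumberTheory.EllipticCurves.Castella2018.cas20_thm211_memberForms_sigmaFrames_congr)) ∧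
      Literature.NumberTheory.EllipticCurves.BCGKPST2020.thm331_rubin_exists_katzMeasure₂_pseudoIso_span_eq ∧
      Literature.NumberTheory.EllipticCurves.DeShalit1987.thmII64_katzMeasure₂_functionalEquation ∧
      Literature.NumberTheory.EllipticCurves.Hida2010MuInvariant.thmI_mu_katzBranch_reflect_eq_zero)
    (hPre :
    Literature.NumberTheory.EllipticCurves.KellerYin2024.thm308_imc2_hidaMember_dvd_OPEN ∧
      Literature.NumberTheory.EllipticCurves.KellerYin2024.thm222_anacong_hidaMember_sigma_mu_OPEN ∧
      Literature.NumberTheory.EllipticCurves.KellerYin2024.thm222_anacong_hidaMember_sigma_lambda_OPEN)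
    (hRat : Literature.NumberTheory.EllipticCurves.hida1986_castella2020_exists_rationalMembers_on_pNewBranchChart)
    (hMazur :
    Summit.BirchSwinnertonDyer.BirchSwinnertonDyer.Theses.EisensteinPrimes.MazurMCOnCellB) :
    Summit.BirchSwinnertonDyer.BirchSwinnertonDyer.Theses.EisensteinPrimes.BSDpOnCellC := by
  obtain ⟨⟨⟨⟨⟨h1, h2, h3, h4, h5, h6, h7, h8, h10, h11, h12, h13⟩, h14⟩, h15⟩, hB⟩, h21, h22, h23⟩ := hPub
  exact EisensteinPrimesBSDpOnCellCOfCitedFactsR3.bsdpOnCellC_of_citedFactsR_pre3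
    ⟨⟨⟨⟨⟨h1, h2, h3, h4, h5, h6, h7, h8,
      EisensteinPrimesBSDpOnCellCKolyvaginOfGZK.forall_kolyvagin_of_rank_eq_analyticRank h10 h6 h8,
      h10, h11, h12, h13⟩, h14⟩, h15⟩, hB⟩, h21, h22, h23⟩ hPre hRat hMazur

end Summit.BirchSwinnertonDyer.BirchSwinnertonDyer.Theorems.EisensteinPrimesBSDpOnCellCOfCitedFactsR4

end
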